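import Literature.AlgebraicGeometry.Resolution.LogRegularRefinementChart
import Literature.AlgebraicGeometry.Resolution.LogRegularRefinementModel
import Literature.AlgebraicGeometry.Resolution.AdicQuotient
import Literature.AlgebraicGeometry.Resolution.AdicCompletionRegular
import Literature.AlgebraicGeometry.Resolution.FormalFibres
import Literature.AlgebraicGeometry.Resolution.FormalBranchesLocal
import Literature.RingTheory.CompleteLocalRings.CoefficientDVR
import Mathlib.RingTheory.AdicCompletion.LocalRing
import HarnessLib

/-!
# Kato's refinement theorem: the refined chart of a log regular local ring is regular (10.3)

`Literature/AlgebraicGeometry/Resolution/LogRegularRefinement.lean`. K. Kato, *Toric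
singularities*, Amer. J. Math. 116 (1994), Thm. (10.3)/(10.4) (with (9.9)): for a log regular
`(X, M)` with chart `P → 𝒪_{X,x}` and a regular cone of a subdivision, i.e. `P ⊆ ℕ^N` via
`c : P → ℕ^N` with `c⁻¹(0) = 0`, the modification is locally `X′ = Spec A[T]/(φ(p) − T^{c p})`
and "`X′` is regular" ((10.4): `M_{X′,x′} = ℕ^r` free, so `X′` is regular by the structure
theorem). We PROVE the local statement at the closed point `𝔔 = (𝔪_A, T)` of the chart, for a
COMPLETE Noetherian local ring `A` in the d = 0 normal form (regular parameters absorbed into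
the chart; `dim A = rank P`):

* `ringHom_ext_mvPowerSeries` — ring maps out of `Λ⟦T₁,…,T_N⟧` into a Noetherian local ring,
  sending the `Tᵢ` into `𝔪`, are determined by their values on `Λ` and the `Tᵢ` (automatic
  continuity);
* `le_ringKrullDim_localization_of_model` — the COMPLETION SANDWICH: given Kato's structure
  `A ≅ Λ⟦P⟧/(θ)` (`LogRegularCompleteStructure`), the completed local ring of the chart at `𝔔`
  surjects onto the model `Λ⟦T⟧/(θ′)` (`θ′ = c_* θ`), so `dim B_(closedPoint φ c P hφ0 hφm hc0 hc) ≥ dim Λ⟦T⟧/(θ′)`;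
* `isRegularLocalRing_localization_closedPoint` — **(10.3)**: `B_(closedPoint φ c P hφ0 hφm hc0 hc)` is a regular local ring
  of dimension `N` (embedding dimension `≤ N` by `LogRegularRefinementChart`, dimension `≥ N` by
  the sandwich with the regular models of `LogRegularRefinementModel`, in both the mixed and the
  equal characteristic case via `CoefficientDVR`).

References: [Kato1994] K. Kato, Toric singularities, Amer. J. Math. 116 (1994), (3.1)–(3.2),
(9.9), (10.3)–(10.4); [Matsumura1987] H. Matsumura, Commutative Ring Theory, Thm. 8.4.
-/

noncomputable section

open IsLocalRing MvPowerSeries Literature.RingTheory.MvPowerSeries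
  Literature.RingTheory.MvPowerSeries.monoidPowerSeries

namespace Literature.AlgebraicGeometry.Resolution

namespace LogRegularCompleteStructure

universe u v

/-! ### Automatic continuity: ring maps out of `Λ⟦T⟧` -/

/-- `X^d = ∏ Xᵢ^{dᵢ}` in `Λ⟦T₁,…,T_N⟧`. [folklore] -/
private theorem monomial_one_eq_prod {Λ : Type u} [CommRing Λ] {N : ℕ} (d : Fin N →₀ ℕ) :
    MvPowerSeries.monomial d (1 : Λ) =
      d.prod fun i n => (MvPowerSeries.X i : MvPowerSeries (Fin N) Λ) ^ n := by
  classical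
  have h := prod_pow_monomial (R := Λ) (fun i : Fin N => Finsupp.single i 1) d
  have hexp : expSum (fun i : Fin N => Finsupp.single i 1) d = d := by
    unfold expSum
    simp only [Finsupp.smul_single_one]
    exact d.sum_single
  rw [hexp] at h
  rw [← h]
  rfl

/-- **Automatic continuity.** Two ring homomorphisms `Λ⟦T₁,…,T_N⟧ → R′` into a Noetherian local
ring which agree on the constants and on the variables, and send the variables into `𝔪_{R′}`,
are equal (they agree on polynomials, and the tails go to `⋂ₙ 𝔪ⁿ = 0`).
[cite: Matsumura1987, Thm. 8.4] -/
theorem ringHom_ext_mvPowerSeries {Λ : Type u} [CommRing Λ] {N : ℕ} {R' : Type v} [CommRing R']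
    [IsLocalRing R'] [IsNoetherianRing R'] (g₁ g₂ : MvPowerSeries (Fin N) Λ →+* R')
    (hX : ∀ i, g₁ (MvPowerSeries.X i) = g₂ (MvPowerSeries.X i))
    (hXm : ∀ i, g₁ (MvPowerSeries.X i) ∈ maximalIdeal R')
    (hC : ∀ l, g₁ (MvPowerSeries.C l) = g₂ (MvPowerSeries.C l)) : g₁ = g₂ := by
  classical
  have hXm₂ : ∀ i, g₂ (MvPowerSeries.X i) ∈ maximalIdeal R' := fun i => hX i ▸ hXm i
  have hmon : ∀ (d : Fin N →₀ ℕ) (a : Λ),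
      g₁ (MvPowerSeries.monomial d a) = g₂ (MvPowerSeries.monomial d a) := by
    intro d a
    rw [monomial_eq_C_mul_monomial_one, map_mul, map_mul, hC, monomial_one_eq_prod,
      map_finsuppProd, map_finsuppProd]
    congr 1
    refine Finsupp.prod_congr fun i _ => ?_
    rw [map_pow, map_pow, hX]
  refine RingHom.ext fun F => ?_
  rw [← sub_eq_zero, ← Ideal.mem_bot,
    ← Ideal.iInf_pow_eq_bot_of_isLocalRing (maximalIdeal R') (maximalIdeal.isMaximal R').ne_top,
    Ideal.mem_iInf]
  intro n
  have hsplit : F = lowPart (R := Λ) n F + (F - lowPart (R := Λ) n F) := by ring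
  have hlow : g₁ (lowPart (R := Λ) n F) = g₂ (lowPart (R := Λ) n F) := by
    rw [lowPart_eq_sum, map_sum, map_sum]
    exact Finset.sum_congr rfl fun d _ => hmon d _
  have h1 := map_mem_pow_of_coeff_eq_zero g₁ (maximalIdeal R') hXm
    (fun e he => coeff_sub_lowPart_of_lt (R := Λ) n F he)
  have h2 := map_mem_pow_of_coeff_eq_zero g₂ (maximalIdeal R') hXm₂
    (fun e he => coeff_sub_lowPart_of_lt (R := Λ) n F he)
  rw [hsplit, map_add, map_add, hlow, add_sub_add_left_eq_sub]
  exact Ideal.sub_mem _ h1 h2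

/-! ### The completion sandwich (abstract form) -/

/-- **Completion sandwich.** Let `S` be a Noetherian local ring, `R′` a complete Noetherian local
ring, `ρ : S → R′` with `ρ(𝔪_S) ⊆ 𝔪_{R′}`, `Λ → S` a local homomorphism from a complete local ring
inducing a surjection on residue fields, and `x₁, …, x_N` generators of `𝔪_S`. If a SURJECTION
`q : Λ⟦T₁,…,T_N⟧ → R′` is compatible with `ρ` (`q(Tᵢ) = ρ(xᵢ)`, `q(l) = ρ(l)`), then
`dim R′ ≤ dim S`: the substitution `Λ⟦T⟧ → Ŝ` is onto (Matsumura 8.4) and `Ŝ → R′` composed with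
it is `q`, so `Ŝ ↠ R′` and `dim R′ ≤ dim Ŝ = dim S`. [cite: Kato1994, (10.3)]
[cite: Matsumura1987, Thm. 8.4] -/
theorem ringKrullDim_le_of_completion_sandwich {Λ : Type u} [CommRing Λ] [IsLocalRing Λ]
    [IsAdicComplete (maximalIdeal Λ) Λ]
    {S : Type u} [CommRing S] [IsLocalRing S] [IsNoetherianRing S]
    {R' : Type u} [CommRing R'] [IsLocalRing R'] [IsNoetherianRing R']
    [IsAdicComplete (maximalIdeal R') R'] {N : ℕ}
    (jS : Λ →+* S) [IsLocalHom jS] (hresS : ∀ s : S, ∃ l : Λ, s - jS l ∈ maximalIdeal S)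
    (x : Fin N → S) (hx : maximalIdeal S = Ideal.span (Set.range x))
    (ρ : S →+* R') (hρ : (maximalIdeal S).map ρ ≤ maximalIdeal R')
    (q : MvPowerSeries (Fin N) Λ →+* R') (hq : Function.Surjective q)
    (hqX : ∀ i, q (MvPowerSeries.X i) = ρ (x i)) (hqC : ∀ l, q (MvPowerSeries.C l) = ρ (jS l)) :
    ringKrullDim R' ≤ ringKrullDim S := by
  classical
  rw [← ringKrullDim_adicCompletion S]
  haveI : IsNoetherianRing (AdicCompletion (maximalIdeal S) S) :=
    isNoetherianRing_adicCompletion_maximalIdeal S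
  -- `β : Ŝ → R'`
  let β : AdicCompletion (maximalIdeal S) S →+* R' :=
    (AdicCompletion.ofAlgEquiv (maximalIdeal R')).symm.toRingHom.comp
      (adicCompletionMap (maximalIdeal S) (maximalIdeal R') ρ hρ)
  have hβof : ∀ s, β (AdicCompletion.of (maximalIdeal S) S s) = ρ s := by
    intro s
    show (AdicCompletion.ofAlgEquiv _).symm (adicCompletionMap _ _ ρ hρ (AdicCompletion.of _ _ s)) = _
    rw [adicCompletionMap_of, AdicCompletion.ofAlgEquiv_symm_of]
  -- `α : Λ⟦T⟧ → Ŝ` onto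
  have hofmem : ∀ s ∈ maximalIdeal S, algebraMap S (AdicCompletion (maximalIdeal S) S) s ∈
      maximalIdeal (AdicCompletion (maximalIdeal S) S) := by
    intro s hs
    rw [AdicCompletion.maximalIdeal_eq_map]
    exact Ideal.mem_map_of_mem _ hs
  have hβalg : ∀ s, β (algebraMap S (AdicCompletion (maximalIdeal S) S) s) = ρ s := fun s => hβof s
  let jT : Λ →+* AdicCompletion (maximalIdeal S) S :=
    (algebraMap S (AdicCompletion (maximalIdeal S) S)).comp jS
  haveI : IsLocalHom jT := by
    refine ⟨fun l hl => ?_⟩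
    by_contra hln
    have h1 : jS l ∈ maximalIdeal S := (mem_maximalIdeal _).2 (mem_nonunits_iff.2
      fun hu => hln (isUnit_of_map_unit jS l hu))
    exact ((mem_maximalIdeal _).1 (hofmem _ h1)) hl
  have hresT : ∀ y, ∃ l : Λ, y - jT l ∈ maximalIdeal (AdicCompletion (maximalIdeal S) S) := by
    intro y
    obtain ⟨s, hs⟩ := exists_sub_algebraMap_mem_maximalIdeal_adicCompletion (A := S) y
    obtain ⟨l, hl⟩ := hresS s
    refine ⟨l, ?_⟩
    have h2 := hofmem _ hl
    rw [map_sub] at h2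
    have := Ideal.add_mem _ hs h2
    rwa [sub_add_sub_cancel] at this
  let xT : Fin N → AdicCompletion (maximalIdeal S) S := fun i =>
    algebraMap S (AdicCompletion (maximalIdeal S) S) (x i)
  have hxTm : ∀ i, xT i ∈ maximalIdeal _ := fun i =>
    hofmem _ (hx ▸ Ideal.subset_span ⟨i, rfl⟩)
  have hgenT : maximalIdeal (AdicCompletion (maximalIdeal S) S) ≤
      Ideal.span (Set.range xT) ⊔ (maximalIdeal Λ).map jT := by
    refine le_trans (le_of_eq ?_) le_sup_left
    rw [AdicCompletion.maximalIdeal_eq_map]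
    have h1 := congrArg (Ideal.map (algebraMap S (AdicCompletion (maximalIdeal S) S))) hx
    rw [h1, Ideal.map_span, ← Set.range_comp]
    rfl
  obtain ⟨α, hαX, hαC, hαsurj⟩ :=
    exists_mvPowerSeries_ringHom_surjective_of_base jT hresT xT hxTm hgenT
  -- `β ∘ α = q`
  have hβα : β.comp α = q := by
    refine ringHom_ext_mvPowerSeries _ _ (fun i => ?_) (fun i => ?_) (fun l => ?_)
    · rw [RingHom.comp_apply, hαX, hqX]
      exact hβalg (x i)
    · rw [RingHom.comp_apply, hαX]
      show β (algebraMap S _ (x i)) ∈ _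
      rw [hβalg]
      exact hρ (Ideal.mem_map_of_mem _ (hx ▸ Ideal.subset_span ⟨i, rfl⟩))
    · rw [RingHom.comp_apply, hαC, hqC]
      exact hβalg (jS l)
  have hβsurj : Function.Surjective β := by
    intro r
    obtain ⟨F, rfl⟩ := hq r
    exact ⟨α F, by rw [← RingHom.comp_apply, hβα]⟩
  exact ringKrullDim_le_of_surjective β hβsurj

/-! ### The refined chart -/

section Chart

variable {A : Type u} [CommRing A] [IsLocalRing A]
  {M N : ℕ} {P : AddSubmonoid (Fin M →₀ ℕ)}
  {φ : (Fin M →₀ ℕ) → A} {c : (Fin M →₀ ℕ) → (Fin N →₀ ℕ)}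
  (hφ0 : φ 0 = 1) (hφm : ∀ p ∈ P, p ≠ 0 → φ p ∈ maximalIdeal A) (hc0 : c 0 = 0)
  (hc : ∀ p ∈ P, p ≠ 0 → c p ≠ 0)

/-- Residue approximation in `B_𝔔`: every element of the localisation is congruent modulo
`𝔪_{B_𝔔}` to the image of a constant `a ∈ A`. [cite: Kato1994, (10.3)] -/
theorem exists_sub_algebraMap_C_mem
    (s : letI := isMaximal_closedPoint hφ0 hφm hc0 hc
      Localization.AtPrime (closedPoint φ c P hφ0 hφm hc0 hc)) :
    letI := isMaximal_closedPoint hφ0 hφm hc0 hc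
    ∃ a : A, s - algebraMap (RefinementRing φ c P) _
        (Ideal.Quotient.mk (refinementIdeal φ c P) (MvPolynomial.C a)) ∈
      maximalIdeal (Localization.AtPrime (closedPoint φ c P hφ0 hφm hc0 hc)) := by
  classical
  letI := isMaximal_closedPoint hφ0 hφm hc0 hc
  haveI : IsField (RefinementRing φ c P ⧸ closedPoint φ c P hφ0 hφm hc0 hc) :=
    (Ideal.Quotient.maximal_ideal_iff_isField_quotient _).1 inferInstance
  obtain ⟨⟨b, u⟩, hbu⟩ := IsLocalization.mk'_surjective (closedPoint φ c P hφ0 hφm hc0 hc).primeCompl s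
  -- an inverse of `u` modulo `𝔔`
  have hu0 : Ideal.Quotient.mk (closedPoint φ c P hφ0 hφm hc0 hc) (u : RefinementRing φ c P) ≠ 0 := by
    rw [Ne, Ideal.Quotient.eq_zero_iff_mem]
    exact u.2
  obtain ⟨vbar, hv⟩ := (this.mul_inv_cancel hu0)
  obtain ⟨v, rfl⟩ := Ideal.Quotient.mk_surjective vbar
  have huv : 1 - (u : RefinementRing φ c P) * v ∈ closedPoint φ c P hφ0 hφm hc0 hc := by
    rw [← Ideal.Quotient.eq_zero_iff_mem, map_sub, map_one, map_mul, hv, sub_self]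
  -- the constant coefficient of a lift of `b * v`
  obtain ⟨f, hf⟩ := Ideal.Quotient.mk_surjective (b * v)
  refine ⟨MvPolynomial.constantCoeff f, ?_⟩
  have h1 : s - algebraMap _ (Localization.AtPrime (closedPoint φ c P hφ0 hφm hc0 hc)) (b * v) ∈
      maximalIdeal (Localization.AtPrime (closedPoint φ c P hφ0 hφm hc0 hc)) := by
    have hs : s * algebraMap _ _ (u : RefinementRing φ c P) = algebraMap _ _ b := by
      rw [← hbu]; exact IsLocalization.mk'_spec _ b u
    have : s - algebraMap _ (Localization.AtPrime (closedPoint φ c P hφ0 hφm hc0 hc)) (b * v) =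
        s * algebraMap _ _ (1 - (u : RefinementRing φ c P) * v) := by
      rw [map_sub, map_one, map_mul, map_mul, ← hs]; ring
    rw [this, ← Localization.AtPrime.map_eq_maximalIdeal]
    exact Ideal.mul_mem_left _ _ (Ideal.mem_map_of_mem _ huv)
  have h2 : b * v - Ideal.Quotient.mk (refinementIdeal φ c P)
      (MvPolynomial.C (MvPolynomial.constantCoeff f)) ∈ closedPoint φ c P hφ0 hφm hc0 hc := by
    rw [← hf]
    unfold closedPoint residueChar
    rw [RingHom.mem_ker, map_sub, lift_mk, lift_mk_C, MvPolynomial.eval₂Hom_zero'_apply, sub_self]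
  have h3 := Ideal.mem_map_of_mem
    (algebraMap _ (Localization.AtPrime (closedPoint φ c P hφ0 hφm hc0 hc))) h2
  rw [Localization.AtPrime.map_eq_maximalIdeal, map_sub] at h3
  have := Ideal.add_mem _ h1 h3
  rwa [sub_add_sub_cancel] at this

variable [IsNoetherianRing A]
  {Λ : Type u} [CommRing Λ] [IsLocalRing Λ] [IsNoetherianRing Λ] [IsAdicComplete (maximalIdeal Λ) Λ]

set_option maxHeartbeats 800000 in
/-- **Kato (10.3) via (3.1), dimension part.** Let `A` be a Noetherian local ring with a chart
`φ : P → A` (`φ(P ∖ 0) ⊆ 𝔪_A` generating `𝔪_A`), `Λ → A` a local homomorphism from a complete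
Noetherian local ring inducing a surjection on residue fields, `ψ : Λ⟦P⟧ ↠ A` the induced
surjection with `ker ψ = (θ)` (Kato's structure theorem), and `c : P → ℕ^N` a refinement with
finite fibres and `c⁻¹(0) = 0`. Then `dim Λ⟦T₁,…,T_N⟧/(c_*θ) ≤ dim B_𝔔` for the refined chart
`B` at its closed point `𝔔`. [cite: Kato1994, (10.3)] -/
theorem ringKrullDim_model_le (j : Λ →+* A) [IsLocalHom j]
    (hres : ∀ a : A, ∃ l : Λ, a - j l ∈ maximalIdeal A)
    (hgen : maximalIdeal A ≤ Ideal.span (φ '' {p | p ∈ P ∧ p ≠ 0}))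
    (hfin : ∀ e : Fin N →₀ ℕ, {p : Fin M →₀ ℕ | p ∈ P ∧ c p = e}.Finite)
    (hadd : ∀ a ∈ P, ∀ b ∈ P, c (a + b) = c a + c b)
    (ψ : monoidPowerSeries Λ P →+* A) (hψsurj : Function.Surjective ψ)
    (hψmon : ∀ (p : Fin M →₀ ℕ) (hp : p ∈ P),
      ψ ⟨MvPowerSeries.monomial p (1 : Λ), monomial_mem hp 1⟩ = φ p)
    (hψC : ∀ l : Λ, ψ ⟨MvPowerSeries.C l, C_mem l⟩ = j l)
    (θ : monoidPowerSeries Λ P) (hker : RingHom.ker ψ = Ideal.span {θ})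
    (hθm : MvPowerSeries.constantCoeff (θ : MvPowerSeries (Fin M) Λ) ∈ maximalIdeal Λ)
    (θ' : MvPowerSeries (Fin N) Λ)
    (hθ'def : (pushforward (R := Λ) c hfin hc0 hadd θ : MvPowerSeries (Fin N) Λ) = θ') :
    letI := isMaximal_closedPoint hφ0 hφm hc0 hc
    ringKrullDim (MvPowerSeries (Fin N) Λ ⧸ Ideal.span {θ'}) ≤
      ringKrullDim (Localization.AtPrime (closedPoint φ c P hφ0 hφm hc0 hc)) := by
  classical
  letI := isMaximal_closedPoint hφ0 hφm hc0 hc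
  -- the model `R' = Λ⟦T⟧/(θ')`: local, Noetherian, complete
  haveI hEnoeth : IsNoetherianRing (MvPowerSeries (Fin N) Λ) := isNoetherianRing_mvPowerSeries Λ (Fin N)
  haveI hEcomp : IsAdicComplete (maximalIdeal (MvPowerSeries (Fin N) Λ)) (MvPowerSeries (Fin N) Λ) :=
    Literature.NumberTheory.GaloisRepresentations.NearlyOrdinaryPresentationCA.isAdicComplete_maximalIdeal_mvPowerSeries
      Λ N
  have hθ'm : θ' ∈ maximalIdeal (MvPowerSeries (Fin N) Λ) := by
    rw [mem_maximalIdeal, mem_nonunits_iff]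
    intro hu
    have h := MvPowerSeries.isUnit_constantCoeff _ hu
    rw [← hθ'def, constantCoeff_pushforward c hfin hc0 hadd (fun p hp h0 => by
      by_contra hne; exact hc p hp hne h0) θ] at h
    exact ((mem_maximalIdeal _).1 hθm) h
  haveI hR'loc : IsLocalRing (MvPowerSeries (Fin N) Λ ⧸ Ideal.span {θ'}) :=
    isLocalRing_quotient (Ideal.span_singleton_ne_top hθ'm)
  haveI hR'comp : IsAdicComplete (maximalIdeal (MvPowerSeries (Fin N) Λ ⧸ Ideal.span {θ'}))
      (MvPowerSeries (Fin N) Λ ⧸ Ideal.span {θ'}) := isAdicComplete_quotient _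
  -- `ρ_A : A → R'`, `a = ψ f ↦ [c_* f]`
  let mk' : MvPowerSeries (Fin N) Λ →+* MvPowerSeries (Fin N) Λ ⧸ Ideal.span {θ'} :=
    Ideal.Quotient.mk (Ideal.span {θ'})
  have hkill : ∀ f ∈ RingHom.ker ψ,
      (mk'.comp (pushforward (R := Λ) c hfin hc0 hadd).toRingHom) f = 0 := by
    intro f hf
    rw [hker, Ideal.mem_span_singleton] at hf
    obtain ⟨g, rfl⟩ := hf
    rw [RingHom.comp_apply, AlgHom.toRingHom_eq_coe, AlgHom.coe_toRingHom, map_mul,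
      Ideal.Quotient.eq_zero_iff_mem]
    rw [hθ'def]
    exact Ideal.mul_mem_right _ _ (Ideal.subset_span (Set.mem_singleton θ'))
  let e : (monoidPowerSeries Λ P ⧸ RingHom.ker ψ) ≃+* A := RingHom.quotientKerEquivOfSurjective hψsurj
  let ρA : A →+* MvPowerSeries (Fin N) Λ ⧸ Ideal.span {θ'} :=
    (Ideal.Quotient.lift (RingHom.ker ψ) (mk'.comp (pushforward (R := Λ) c hfin hc0 hadd).toRingHom)
      hkill).comp e.symm.toRingHom
  have hρA : ∀ f : monoidPowerSeries Λ P, ρA (ψ f) = mk' (pushforward (R := Λ) c hfin hc0 hadd f) := by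
    intro f
    have he : e.symm (ψ f) = Ideal.Quotient.mk (RingHom.ker ψ) f := by
      rw [RingEquiv.symm_apply_eq]
      exact (RingHom.quotientKerEquivOfSurjective_apply_mk hψsurj f).symm
    show (Ideal.Quotient.lift (RingHom.ker ψ) _ hkill) (e.symm (ψ f)) = _
    rw [he, Ideal.Quotient.lift_mk]
    rfl
  -- `t_i = [T_i]`
  let t : Fin N → MvPowerSeries (Fin N) Λ ⧸ Ideal.span {θ'} := fun i => mk' (MvPowerSeries.X i)
  have htm : ∀ i, t i ∈ maximalIdeal (MvPowerSeries (Fin N) Λ ⧸ Ideal.span {θ'}) := by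
    intro i
    rw [← IsLocalRing.map_maximalIdeal_of_surjective mk' Ideal.Quotient.mk_surjective]
    refine Ideal.mem_map_of_mem _ ((mem_maximalIdeal _).2 (mem_nonunits_iff.2 fun hu => ?_))
    have h := MvPowerSeries.isUnit_constantCoeff _ hu
    rw [MvPowerSeries.constantCoeff_X] at h
    exact not_isUnit_zero h
  have hρAφ : ∀ p ∈ P, ρA (φ p) = (c p).prod fun i n => t i ^ n := by
    intro p hp
    rw [← hψmon p hp, hρA, pushforward_monomial c hfin hc0 hadd hp 1, monomial_one_eq_prod,
      map_finsuppProd]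
    simp only [map_pow, t]
  -- `ρ_S : S → R'`
  let ρS : Localization.AtPrime (closedPoint φ c P hφ0 hφm hc0 hc) →+*
      MvPowerSeries (Fin N) Λ ⧸ Ideal.span {θ'} :=
    liftLocalization hφ0 hφm hc0 hc ρA t hρAφ htm hgen
  have hmapS : (maximalIdeal (Localization.AtPrime (closedPoint φ c P hφ0 hφm hc0 hc))).map ρS ≤
      maximalIdeal (MvPowerSeries (Fin N) Λ ⧸ Ideal.span {θ'}) :=
    map_maximalIdeal_liftLocalization_le hφ0 hφm hc0 hc ρA t hρAφ htm hgen
  -- `j_S : Λ → S`, generators `x`, and the compatibilities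
  let ιS : RefinementRing φ c P →+* Localization.AtPrime (closedPoint φ c P hφ0 hφm hc0 hc) :=
    algebraMap (RefinementRing φ c P) (Localization.AtPrime (closedPoint φ c P hφ0 hφm hc0 hc))
  have hιmem : ∀ b ∈ closedPoint φ c P hφ0 hφm hc0 hc,
      ιS b ∈ maximalIdeal (Localization.AtPrime (closedPoint φ c P hφ0 hφm hc0 hc)) := by
    intro b hb
    rw [← Localization.AtPrime.map_eq_maximalIdeal]
    exact Ideal.mem_map_of_mem _ hb
  let jS : Λ →+* Localization.AtPrime (closedPoint φ c P hφ0 hφm hc0 hc) :=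
    ιS.comp ((Ideal.Quotient.mk (refinementIdeal φ c P)).comp (MvPolynomial.C.comp j))
  have hjS : ∀ l, jS l = ιS (Ideal.Quotient.mk _ (MvPolynomial.C (j l))) := fun l => rfl
  haveI : IsLocalHom jS := by
    refine ⟨fun l hl => ?_⟩
    by_contra hln
    have h1 : j l ∈ maximalIdeal A := (mem_maximalIdeal _).2 (mem_nonunits_iff.2
      fun hu => hln (isUnit_of_map_unit j l hu))
    have h2 := hιmem _ (mk_C_mem_closedPoint hφ0 hφm hc0 hc h1)
    rw [← hjS] at h2
    exact ((mem_maximalIdeal _).1 h2) hl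
  have hresS : ∀ s, ∃ l : Λ, s - jS l ∈
      maximalIdeal (Localization.AtPrime (closedPoint φ c P hφ0 hφm hc0 hc)) := by
    intro s
    obtain ⟨a, ha⟩ := exists_sub_algebraMap_C_mem hφ0 hφm hc0 hc s
    obtain ⟨l, hl⟩ := hres a
    refine ⟨l, ?_⟩
    have h3 : ιS (Ideal.Quotient.mk _ (MvPolynomial.C a)) - jS l ∈ maximalIdeal _ := by
      have h := hιmem _ (mk_C_mem_closedPoint hφ0 hφm hc0 hc hl)
      rwa [map_sub, map_sub, map_sub, ← hjS] at h
    have := Ideal.add_mem _ ha h3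
    rwa [sub_add_sub_cancel] at this
  let x : Fin N → Localization.AtPrime (closedPoint φ c P hφ0 hφm hc0 hc) :=
    fun i => ιS (Ideal.Quotient.mk _ (MvPolynomial.X i))
  have hx : maximalIdeal (Localization.AtPrime (closedPoint φ c P hφ0 hφm hc0 hc)) =
      Ideal.span (Set.range x) := by
    rw [← Localization.AtPrime.map_eq_maximalIdeal]
    have h1 := congrArg (Ideal.map ιS) (closedPoint_eq_span_X hφ0 hφm hc0 hc hgen)
    rw [h1, Ideal.map_span, ← Set.range_comp]
    rfl
  refine ringKrullDim_le_of_completion_sandwich jS hresS x hx ρS hmapS mk'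
    Ideal.Quotient.mk_surjective (fun i => ?_) (fun l => ?_)
  · show t i = liftLocalization hφ0 hφm hc0 hc ρA t hρAφ htm hgen (algebraMap _ _ _)
    rw [liftLocalization_algebraMap, lift_mk_X]
  · rw [hjS]
    show mk' (MvPowerSeries.C l) =
      liftLocalization hφ0 hφm hc0 hc ρA t hρAφ htm hgen (algebraMap _ _ _)
    rw [liftLocalization_algebraMap, lift_mk_C, ← hψC, hρA]
    congr 1
    exact ((pushforward (R := Λ) c hfin hc0 hadd).commutes l).symm

end Chart

end LogRegularCompleteStructure

end Literature.AlgebraicGeometry.Resolution
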